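import Literature.NumberTheory.EllipticCurves.CongruentNumberEvenFiveThreeRankBound
import Literature.NumberTheory.EllipticCurves.CongruentNumberCurvePrimeRank
import HarnessLib

/-!
# `rk E_n(ℚ) = 1` for `n = 30, 70, 174` — the first members of the family `2p₅q₃`, `(p/q) = −1` (Lagrange 1975 / Monsky 1990)

Topic `NumberTheory/EllipticCurves`; namespace `Literature.NumberTheory.EllipticCurves`. Sequel of
`CongruentNumberEvenFiveThreeRankBound.lean` (`rk E_{2pq}(ℚ) ≤ 1` for symbolic primes `p ≡ 5 (8)`, `q ≡ 3 (4)`, by the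
first `2`-descent — Lagrange's «`g ≤ 1`»): the three smallest `n = 2pq` with `(p/q) = −1`, namely `30 = 2·5·3`,
`70 = 2·5·7`, `174 = 2·29·3`, have rank EXACTLY one — `≤ 1` from the descent, `≥ 1` from an explicit rational point
with `y ≠ 0` through the tree's dictionary `Wiles2000.mordellWeilRank_ne_zero_iff_isCongruentNumber`
(`isCongruentNumber_thirty` is the tree's, point `(−20, 100)`; `isCongruentNumber_seventy` (point `(−20, 300)`) and
`isCongruentNumber_oneHundredSeventyFour` (point `(−150, 1080)`) are new). These are the members of the three
book230 isogeny classes of the cell `bsd-monsky` partition (`N ∈ {30, 70, 174}`, conductor `16N²`); Monsky 1990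
Cor. 5.15 (2′) prints `rank E_N(ℚ) = 1` for all `N = 2p₅q₃` (with `#Sel₂ = 8`) — here the rank statement is a kernel
theorem for these three `N`. Everything is proved; no named facts.

## References

* J. Lagrange, *Nombres congruents et courbes elliptiques*, Sém. Delange–Pisot–Poitou 16 (1974/75), exp. 16, §11. [Lagrange1975]
* P. Monsky, *Mock Heegner points and congruent numbers*, Math. Z. 204 (1990) 45–68, Cor. 5.15. [Monsky1990MockHeegner]
-/

noncomputable section

namespace Literature.NumberTheory.EllipticCurves

/-- **`70` is a congruent number** (`2·5·7`, `(5/7) = −1`): the point `(−20, 300)` of `y² = x³ − 70²x`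
(`(−20)³ + 4900·20 = 90000 = 300²`). [cite: Monsky1990MockHeegner, Cor. 5.15 (p. 66)] -/
theorem isCongruentNumber_seventy : IsCongruentNumber 70 :=
  isCongruentNumber_of_equation (n := 70) (by norm_num) (x := -20) (y := 300)
    ((TwoDescentLocal.cn_equation_iff 70 _ _).mpr (by norm_num)) (by norm_num)

/-- **`174` is a congruent number** (`2·29·3`, `(29/3) = −1`): the point `(−150, 1080)` of `y² = x³ − 174²x`
(`(−150)³ + 30276·150 = 1166400 = 1080²`). [cite: Monsky1990MockHeegner, Cor. 5.15 (p. 66)] -/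
theorem isCongruentNumber_oneHundredSeventyFour : IsCongruentNumber 174 :=
  isCongruentNumber_of_equation (n := 174) (by norm_num) (x := -150) (y := 1080)
    ((TwoDescentLocal.cn_equation_iff 174 _ _).mpr (by norm_num)) (by norm_num)

/-- **`rk E_30(ℚ) = 1`** (`30 = 2·5·3`): `≤ 1` by the descent, `≥ 1` since `30` is congruent.
[cite: Lagrange1975, §11 table p. 16-12] [cite: Monsky1990MockHeegner, Cor. 5.15 (2′) (p. 66)] -/
theorem mordellWeilRank_congruentNumberCurve_thirty : (congruentNumberCurve 30).mordellWeilRank = 1 :=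
  le_antisymm
    (mordellWeilRank_le_one_congruentNumberCurve_two_mul_five_mul_three_mod_four (p := 5) (q := 3) (by norm_num)
      (by norm_num) (by norm_num) (by norm_num))
    (Nat.one_le_iff_ne_zero.mpr
      ((Wiles2000.mordellWeilRank_ne_zero_iff_isCongruentNumber (by norm_num)).mpr isCongruentNumber_thirty))

/-- **`rk E_70(ℚ) = 1`** (`70 = 2·5·7`). [cite: Lagrange1975, §11 table p. 16-12]
[cite: Monsky1990MockHeegner, Cor. 5.15 (2′) (p. 66)] -/
theorem mordellWeilRank_congruentNumberCurve_seventy : (congruentNumberCurve 70).mordellWeilRank = 1 :=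
  le_antisymm
    (mordellWeilRank_le_one_congruentNumberCurve_two_mul_five_mul_three_mod_four (p := 5) (q := 7) (by norm_num)
      (by norm_num) (by norm_num) (by norm_num))
    (Nat.one_le_iff_ne_zero.mpr
      ((Wiles2000.mordellWeilRank_ne_zero_iff_isCongruentNumber (by norm_num)).mpr isCongruentNumber_seventy))

/-- **`rk E_174(ℚ) = 1`** (`174 = 2·29·3`). [cite: Lagrange1975, §11 table p. 16-12]
[cite: Monsky1990MockHeegner, Cor. 5.15 (2′) (p. 66)] -/
theorem mordellWeilRank_congruentNumberCurve_oneHundredSeventyFour :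
    (congruentNumberCurve 174).mordellWeilRank = 1 :=
  le_antisymm
    (mordellWeilRank_le_one_congruentNumberCurve_two_mul_five_mul_three_mod_four (p := 29) (q := 3) (by norm_num)
      (by norm_num) (by norm_num) (by norm_num))
    (Nat.one_le_iff_ne_zero.mpr
      ((Wiles2000.mordellWeilRank_ne_zero_iff_isCongruentNumber (by norm_num)).mpr
        isCongruentNumber_oneHundredSeventyFour))

end Literature.NumberTheory.EllipticCurves

end
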